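import Mathlib.MeasureTheory.Integral.DominatedConvergence
import Literature.NumberTheory.Transcendental.KZCalculus
import Literature.NumberTheory.Transcendental.SemialgebraicMapsProofs
import HarnessLib

/-!
# Dominated families of integral representations (Kontsevich–Zagier calculus)

Definition request `defn-KZ.IsDominatedFamily` (route KontsevichZagierPeriods/ValuedFieldSpecialisation,
items CTConstruction (CT3), ParametricLifting, ClassLevelExpansion(FibreDimOne),
DominatedSliceTendsto). Companion to `KZCalculus.lean`.

An `(n+1)`-dimensional integral representation `R : KZ.IntegralRep (n + 1)` is read as the
one-parameter *family* of its slices over the parameter `s = z 0`: the slice over `s` is the set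
`{x : ℝⁿ | (s, x) ∈ R.domain}` with the integrand `x ↦ R.integrand (s, x)` (`(s, x)` is
`Matrix.vecCons s x`), and its *slice integral* is
`I_R(s) = ∫ x in {x | vecCons s x ∈ R.domain}, R.integrand (vecCons s x)`.
The family is *dominated near `s = 0⁺` with a.e. special fibre `r₀`*
(`KZ.IsDominatedFamily R r₀ g`) when, exactly as in the hypotheses of Lebesgue's dominated
convergence theorem along `𝓝[>] 0`,

1. for `0 < s < ε` every slice lies inside `g.domain` and `|R.integrand (s, x)| ≤ g.integrand x`
   there, for an integral representation `g` in the fibre variables (the integrable envelope);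
2. for a.e. `x`, eventually as `s → 0⁺`, `(s, x) ∈ R.domain ↔ x ∈ r₀.domain` (the indicators
   of the slices converge pointwise a.e. to the indicator of `r₀.domain`);
3. for a.e. `x ∈ r₀.domain`, `R.integrand (s, x) → r₀.integrand x` as `s → 0⁺`.

This is the clause inlined VERBATIM in the route declarations, so that a restatement through this
definition is definitional (`KZ.isDominatedFamily_iff` is `Iff.rfl`).

## Main definitions

* `Literature.NumberTheory.Transcendental.KZ.IsDominatedFamily R r₀ g`.
* `Literature.NumberTheory.Transcendental.KZ.IntegralRep.abs r` — the representation `(σ, |f|)`.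
* `Literature.NumberTheory.Transcendental.KZ.IntegralRep.cylinder r : IntegralRep (n + 1)` — the
  constant family `(0, 1) × σ` with integrand `(s, x) ↦ f x`.

## Main statements

* `KZ.IsDominatedFamily.tendsto_setIntegral` — **dominated families specialise at value level**:
  `I_R(s) → r₀.value` as `s → 0⁺` (Lebesgue dominated convergence,
  `MeasureTheory.tendsto_integral_filter_of_dominated_convergence`; this is the route's support
  item DominatedSliceTendsto, verbatim).
* `KZ.IsDominatedFamily.ae_mem_domain_iff`, `.ae_integrand_eq`, `.value_eq` — the special fibre is
  unique up to a null set, its integrand up to a.e. equality on the domain, its value outright.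
  (That two special fibres differ by an element of `KZ.relations` is proved in the sibling file
  `KZDominatedFamilyRelations.lean`, which needs the congruence lemmas of
  `KZLogCalculusProofs.lean`; this file is kept next to `KZCalculus.lean` in the import order.)
* `KZ.IntegralRep.isDominatedFamily_cylinder` — the constant family over `r` is dominated by
  `r.abs` with special fibre `r` (non-vacuity of the notion).

## References

* M. Kontsevich, D. Zagier, *Periods* (2001), §1.2 (the moves).
* T. Kaiser, *Lebesgue measure and integration theory on non-archimedean real closed fields with
  archimedean value group*, Proc. LMS 116 (2018), Thm. 5.2: Lebesgue's dominated convergence for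
  one-parameter globally subanalytic families `f_s` with `|f_s| ≤ |h|`, `h` integrable, for all
  sufficiently large `s` — the non-archimedean mirror of this notion (there the parameter tends to
  `∞` in the Puiseux field; here `s → 0⁺` in `ℝ`).
* Mathlib, `MeasureTheory.tendsto_integral_filter_of_dominated_convergence`.

## Design notes

* The three clauses are copied from
  `Summits/KontsevichZagierPeriods/KontsevichZagierPeriods/Theses/ValuedFieldSpecialisation.lean`
  (decls `CTConstruction`, `ParametricLifting`, `ClassLevelExpansion`, `DominatedSliceTendsto`);
  the fibre variables of `z : Fin (n + 1) → ℝ` are `fun i : Fin n => z i.succ` and a slice point is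
  `Matrix.vecCons s x`, as there. No `sliceValue` abbreviation is introduced here (requested
  separately as `KZ.sliceValue`); the slice integral is written out.
* Clause 1 bounds `|R.integrand|` by `g.integrand` itself (not `|g.integrand|`), as in the route;
  the dominated-convergence proof uses the integrable envelope `𝟙_{g.domain} |g.integrand|`.
* Measurability of the slices: `R.domain` is `ℚ`-semialgebraic hence Borel
  (`IntegralRep.measurableSet_domain_holds`), `x ↦ vecCons s x` is continuous, and the extension
  by zero `𝟙_{R.domain} R.integrand` is Borel by `IsSemialgebraicFunOn.measurable_indicator_of_tarskiSeidenberg`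
  with `tarski_seidenberg_real_holds`.
-/

noncomputable section

open MeasureTheory Set Filter MvPolynomial
open scoped Topology

namespace Literature.NumberTheory.Transcendental

variable {n : ℕ}

section General

variable {k : Type*} {R : Type*} [CommRing k] [CommRing R] [LT R] [Algebra k R]

/-- If `f` is semialgebraic on `s ⊆ R ^ n` then `(t, x) ↦ f x` is semialgebraic on the cylinder
`{(t, x) | x ∈ s} ⊆ R ^ (n + 1)` (first coordinate free): its graph is the preimage of the graph of
`f` under the coordinate map `(t, x, y) ↦ (x, y)` (no Tarski–Seidenberg needed).
[BCR 1998, §2.2] [cite: BochnakCosteRoy1998, §2.2] -/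
theorem IsSemialgebraicFunOn.comp_tail {s : Set (Fin n → R)} {f : (Fin n → R) → R}
    (hf : IsSemialgebraicFunOn k s f) :
    IsSemialgebraicFunOn k {z : Fin (n + 1) → R | (fun i : Fin n => z i.succ) ∈ s}
      (fun z => f (fun i : Fin n => z i.succ)) := by
  rw [isSemialgebraicFunOn_iff] at hf ⊢
  -- `θ : Fin (n + 1) → Fin (n + 2)` forgets the coordinate `0`: `(t, x, y) ↦ (x, y)`
  set θ : Fin (n + 1) → Fin (n + 2) :=
    Fin.snoc (fun i : Fin n => Fin.castSucc i.succ) (Fin.last (n + 1)) with hθ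
  convert hf.preimage_comp θ using 1
  ext u
  have h1 : Fin.init (u ∘ θ) = fun i : Fin n => Fin.init u i.succ := by
    ext i
    simp [Fin.init, hθ]
  have h2 : (u ∘ θ) (Fin.last n) = u (Fin.last (n + 1)) := by simp [hθ]
  simp only [mem_setOf_eq, mem_preimage, h1, h2]

end General

namespace KZ

/-! ### The definition -/

/-- **Dominated family with a.e. special fibre.** The `(n+1)`-dimensional integral representation
`R`, read as the family of its slices `{x | (s, x) ∈ R.domain}`, `x ↦ R.integrand (s, x)` over the
parameter `s = z 0`, is *dominated near `s = 0⁺` by `g` with a.e. special fibre `r₀`* if: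
(1) for some `ε > 0`, every point `z ∈ R.domain` with `0 < z 0 < ε` has fibre coordinates in
`g.domain` and `|R.integrand z| ≤ g.integrand (fibre coordinates)`; (2) for a.e. `x : ℝⁿ`,
eventually as `s → 0⁺`, `(s, x) ∈ R.domain ↔ x ∈ r₀.domain`; (3) for a.e. `x`, if `x ∈ r₀.domain`
then `R.integrand (s, x) → r₀.integrand x` as `s → 0⁺`. These are the hypotheses of Lebesgue's
dominated convergence theorem for the slices along `𝓝[>] 0` (so the slice integrals tend to
`r₀.value`, `IsDominatedFamily.tendsto_setIntegral`); the non-archimedean mirror for semialgebraic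
one-parameter families is Kaiser 2018, Thm. 5.2. Verbatim the clause inlined in route
ValuedFieldSpecialisation (CT3, ParametricLifting, ClassLevelExpansion, DominatedSliceTendsto).
[folklore] -/
def IsDominatedFamily (R : IntegralRep (n + 1)) (r₀ g : IntegralRep n) : Prop :=
  (∃ ε > (0 : ℝ), ∀ z ∈ R.domain, 0 < z 0 → z 0 < ε → (fun i : Fin n => z i.succ) ∈ g.domain ∧
    |R.integrand z| ≤ g.integrand (fun i : Fin n => z i.succ)) ∧
  (∀ᵐ x : Fin n → ℝ, ∀ᶠ s in nhdsWithin (0 : ℝ) (Set.Ioi 0),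
    (Matrix.vecCons s x ∈ R.domain ↔ x ∈ r₀.domain)) ∧
  (∀ᵐ x : Fin n → ℝ, x ∈ r₀.domain → Filter.Tendsto (fun s : ℝ => R.integrand (Matrix.vecCons s x))
    (nhdsWithin 0 (Set.Ioi 0)) (nhds (r₀.integrand x)))

/-- Unfolding `IsDominatedFamily` into the three clauses exactly as inlined in the route
declarations (definitional: `Iff.rfl`). [folklore] -/
theorem isDominatedFamily_iff (R : IntegralRep (n + 1)) (r₀ g : IntegralRep n) :
    IsDominatedFamily R r₀ g ↔
      ((∃ ε > (0 : ℝ), ∀ z ∈ R.domain, 0 < z 0 → z 0 < ε →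
          (fun i : Fin n => z i.succ) ∈ g.domain ∧
            |R.integrand z| ≤ g.integrand (fun i : Fin n => z i.succ)) ∧
        (∀ᵐ x : Fin n → ℝ, ∀ᶠ s in nhdsWithin (0 : ℝ) (Set.Ioi 0),
          (Matrix.vecCons s x ∈ R.domain ↔ x ∈ r₀.domain)) ∧
        (∀ᵐ x : Fin n → ℝ, x ∈ r₀.domain →
          Filter.Tendsto (fun s : ℝ => R.integrand (Matrix.vecCons s x))
            (nhdsWithin 0 (Set.Ioi 0)) (nhds (r₀.integrand x)))) :=
  Iff.rfl

/-! ### Measurability of slices -/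

/-- The slice embedding `x ↦ (s, x) = vecCons s x : ℝⁿ → ℝⁿ⁺¹` is continuous. [folklore] -/
theorem continuous_vecCons (s : ℝ) : Continuous fun x : Fin n → ℝ => Matrix.vecCons s x := by
  refine continuous_pi fun i => ?_
  refine Fin.cases ?_ (fun j => ?_) i
  · simpa using continuous_const
  · simpa using continuous_apply j

/-- The slice embedding `x ↦ vecCons s x` is measurable. [folklore] -/
theorem measurable_vecCons (s : ℝ) : Measurable fun x : Fin n → ℝ => Matrix.vecCons s x :=
  (continuous_vecCons s).measurable

namespace IntegralRep

/-- Every slice `{x | (s, x) ∈ R.domain}` of the domain of a family is Lebesgue measurable.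
[folklore] -/
theorem measurableSet_slice (R : IntegralRep (n + 1)) (s : ℝ) :
    MeasurableSet {x : Fin n → ℝ | Matrix.vecCons s x ∈ R.domain} :=
  measurable_vecCons s (measurableSet_domain_holds R)

/-- The extension by zero `𝟙_σ f` of the integrand of an integral representation is Borel
(semialgebraic functions are Borel on their domain; Tarski–Seidenberg).
[BCR 1998, §2.2] [cite: BochnakCosteRoy1998, §2.2] -/
theorem measurable_indicator_integrand (r : IntegralRep n) :
    Measurable (r.domain.indicator r.integrand) :=
  r.isSemialgebraicFunOn_integrand.measurable_indicator_of_tarskiSeidenberg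
    Literature.ModelTheory.ExponentialFields.tarski_seidenberg_real_holds (measurableSet_domain_holds r)

/-- The slice integral over `s` is the integral over `ℝⁿ` of `x ↦ (𝟙_σ f) (s, x)`. [folklore] -/
theorem setIntegral_slice_eq_integral_indicator (R : IntegralRep (n + 1)) (s : ℝ) :
    ∫ x in {x : Fin n → ℝ | Matrix.vecCons s x ∈ R.domain}, R.integrand (Matrix.vecCons s x) =
      ∫ x : Fin n → ℝ, R.domain.indicator R.integrand (Matrix.vecCons s x) := by
  rw [← integral_indicator (R.measurableSet_slice s)]
  rfl

end IntegralRep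

/-! ### Dominated convergence of the slice integrals -/

namespace IsDominatedFamily

variable {R : IntegralRep (n + 1)} {r₀ r₀' g g' : IntegralRep n}

/-- Clause (1) of a dominated family: the uniform integrable envelope near `s = 0⁺`. [folklore] -/
theorem exists_bound (h : IsDominatedFamily R r₀ g) :
    ∃ ε > (0 : ℝ), ∀ z ∈ R.domain, 0 < z 0 → z 0 < ε → (fun i : Fin n => z i.succ) ∈ g.domain ∧
      |R.integrand z| ≤ g.integrand (fun i : Fin n => z i.succ) :=
  h.1

/-- Clause (2) of a dominated family: the slices converge a.e. to the special domain. [folklore] -/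
theorem ae_eventually_mem_iff (h : IsDominatedFamily R r₀ g) :
    ∀ᵐ x : Fin n → ℝ, ∀ᶠ s in 𝓝[>] (0 : ℝ), (Matrix.vecCons s x ∈ R.domain ↔ x ∈ r₀.domain) :=
  h.2.1

/-- Clause (3) of a dominated family: the integrands converge a.e. on the special domain.
[folklore] -/
theorem ae_tendsto_integrand (h : IsDominatedFamily R r₀ g) :
    ∀ᵐ x : Fin n → ℝ, x ∈ r₀.domain →
      Tendsto (fun s : ℝ => R.integrand (Matrix.vecCons s x)) (𝓝[>] 0) (𝓝 (r₀.integrand x)) :=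
  h.2.2

/-- **Dominated families specialise at value level** (route support item DominatedSliceTendsto):
the slice integrals `I_R(s) = ∫ x in {x | (s, x) ∈ R.domain}, R.integrand (s, x)` tend to
`r₀.value` as `s → 0⁺`. Proof: Lebesgue's dominated convergence along the countably generated
filter `𝓝[>] 0` (`MeasureTheory.tendsto_integral_filter_of_dominated_convergence`) for
`F_s = (𝟙_{R.domain} R.integrand) (s, ·)`, envelope `𝟙_{g.domain} |g.integrand|`, the a.e. limit
`𝟙_{r₀.domain} r₀.integrand` coming from clauses (2) and (3).
[Kaiser 2018, Thm. 5.2 (non-archimedean mirror); Lebesgue] [folklore] -/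
theorem tendsto_setIntegral (h : IsDominatedFamily R r₀ g) :
    Tendsto (fun s : ℝ => ∫ x in {x : Fin n → ℝ | Matrix.vecCons s x ∈ R.domain},
      R.integrand (Matrix.vecCons s x)) (𝓝[>] 0) (𝓝 r₀.value) := by
  obtain ⟨⟨ε, hε, hdom⟩, hmem, hlim⟩ := h
  simp_rw [IntegralRep.setIntegral_slice_eq_integral_indicator]
  rw [IntegralRep.value, ← integral_indicator (IntegralRep.measurableSet_domain_holds r₀)]
  refine tendsto_integral_filter_of_dominated_convergence
    (fun x => g.domain.indicator (fun y => |g.integrand y|) x) ?_ ?_ ?_ ?_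
  · exact Eventually.of_forall fun s =>
      ((IntegralRep.measurable_indicator_integrand R).comp (measurable_vecCons s)).aestronglyMeasurable
  · have hs : ∀ᶠ s in 𝓝[>] (0 : ℝ), s ∈ Ioo 0 ε := Ioo_mem_nhdsGT hε
    filter_upwards [hs] with s hs
    refine Eventually.of_forall fun x => ?_
    by_cases hx : Matrix.vecCons s x ∈ R.domain
    · obtain ⟨hxg, hle⟩ := hdom _ hx (by simpa using hs.1) (by simpa using hs.2)
      have hxg' : x ∈ g.domain := by simpa using hxg
      have hle' : |R.integrand (Matrix.vecCons s x)| ≤ g.integrand x := by simpa using hle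
      rw [indicator_of_mem hx, indicator_of_mem hxg', Real.norm_eq_abs]
      exact hle'.trans (le_abs_self _)
    · rw [indicator_of_notMem hx, norm_zero]
      exact indicator_nonneg (fun _ _ => abs_nonneg _) _
  · exact (integrable_indicator_iff (IntegralRep.measurableSet_domain_holds g)).mpr
      g.integrableOn.abs
  · filter_upwards [hmem, hlim] with x hx₁ hx₂
    by_cases hx : x ∈ r₀.domain
    · rw [indicator_of_mem hx]
      refine (hx₂ hx).congr' ?_
      filter_upwards [hx₁] with s hs
      rw [indicator_of_mem (hs.mpr hx)]
    · rw [indicator_of_notMem hx]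
      refine tendsto_const_nhds.congr' ?_
      filter_upwards [hx₁] with s hs
      rw [indicator_of_notMem (fun h' => hx (hs.mp h'))]

/-! ### Uniqueness of the special fibre -/

/-- Two special fibres of the same family have a.e. the same domain: for a.e. `x` both
equivalences of clause (2) hold for some common `s > 0`. [folklore] -/
theorem ae_mem_domain_iff (h : IsDominatedFamily R r₀ g) (h' : IsDominatedFamily R r₀' g') :
    ∀ᵐ x : Fin n → ℝ, x ∈ r₀.domain ↔ x ∈ r₀'.domain := by
  filter_upwards [h.2.1, h'.2.1] with x hx hx'
  obtain ⟨s, hs, hs'⟩ := (hx.and hx').exists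
  exact hs.symm.trans hs'

/-- Two special fibres of the same family have a.e. equal domains. [folklore] -/
theorem domain_ae_eq (h : IsDominatedFamily R r₀ g) (h' : IsDominatedFamily R r₀' g') :
    r₀.domain =ᵐ[volume] r₀'.domain :=
  Filter.eventuallyEq_set.mpr (h.ae_mem_domain_iff h')

/-- Two special fibres of the same family have a.e. the same integrand on their common domain
(uniqueness of limits along the non-trivial filter `𝓝[>] 0`). [folklore] -/
theorem ae_integrand_eq (h : IsDominatedFamily R r₀ g) (h' : IsDominatedFamily R r₀' g') :
    ∀ᵐ x : Fin n → ℝ, x ∈ r₀.domain → x ∈ r₀'.domain → r₀.integrand x = r₀'.integrand x := by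
  filter_upwards [h.2.2, h'.2.2] with x hx hx' hm hm'
  exact tendsto_nhds_unique (hx hm) (hx' hm')

/-- Two special fibres of the same family have a.e. equal integrands extended by zero. [folklore] -/
theorem indicator_integrand_ae_eq (h : IsDominatedFamily R r₀ g) (h' : IsDominatedFamily R r₀' g') :
    r₀.domain.indicator r₀.integrand =ᵐ[volume] r₀'.domain.indicator r₀'.integrand := by
  filter_upwards [h.ae_mem_domain_iff h', h.ae_integrand_eq h'] with x h₁ h₂
  by_cases hx : x ∈ r₀.domain
  · rw [indicator_of_mem hx, indicator_of_mem (h₁.mp hx), h₂ hx (h₁.mp hx)]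
  · rw [indicator_of_notMem hx, indicator_of_notMem (fun hx' => hx (h₁.mpr hx'))]

/-- **The special fibre is unique at value level**: two special fibres of one dominated family
represent the same number. [folklore] -/
theorem value_eq (h : IsDominatedFamily R r₀ g) (h' : IsDominatedFamily R r₀' g') :
    r₀.value = r₀'.value := by
  simp only [IntegralRep.value]
  rw [← integral_indicator (IntegralRep.measurableSet_domain_holds r₀),
    ← integral_indicator (IntegralRep.measurableSet_domain_holds r₀')]
  exact integral_congr_ae (h.indicator_integrand_ae_eq h')

end IsDominatedFamily

/-! ### The constant family -/

namespace IntegralRep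

variable (r : IntegralRep n)

/-- The representation `(σ, |f|)` of the absolute integrand. [KZ 2001, §1.1] [cite: KontsevichZagier2001, §1.1] -/
def abs : IntegralRep n where
  domain := r.domain
  integrand x := |r.integrand x|
  isSemialgebraic_domain := r.isSemialgebraic_domain
  isSemialgebraicFunOn_integrand := r.isSemialgebraicFunOn_integrand.abs
  integrableOn := r.integrableOn.abs

/-- The domain of `r.abs`. [KZ 2001, §1.1] [cite: KontsevichZagier2001, §1.1] -/
@[simp] lemma domain_abs : r.abs.domain = r.domain := rfl

/-- The integrand of `r.abs`. [KZ 2001, §1.1] [cite: KontsevichZagier2001, §1.1] -/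
@[simp] lemma integrand_abs : r.abs.integrand = fun x => |r.integrand x| := rfl

/-- The domain `(0, 1) × σ ⊆ ℝⁿ⁺¹` of the constant family over `σ` (parameter in coordinate `0`).
[KZ 2001, §1.2] [cite: KontsevichZagier2001, §1.2] -/
def cylinderDomain : Set (Fin (n + 1) → ℝ) :=
  {z | 0 < z 0 ∧ z 0 < 1 ∧ (fun i : Fin n => z i.succ) ∈ r.domain}

/-- Slice membership in the cylinder. [KZ 2001, §1.2] [cite: KontsevichZagier2001, §1.2] -/
lemma vecCons_mem_cylinderDomain {s : ℝ} {x : Fin n → ℝ} :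
    Matrix.vecCons s x ∈ r.cylinderDomain ↔ (0 < s ∧ s < 1) ∧ x ∈ r.domain := by
  simp [cylinderDomain, and_assoc]

/-- The cylinder `(0, 1) × σ` is `ℚ`-semialgebraic. [BCR 1998, §2.1] [cite: BochnakCosteRoy1998, §2.1] -/
lemma isSemialgebraic_cylinderDomain :
    Literature.ModelTheory.ExponentialFields.IsSemialgebraic ℚ r.cylinderDomain := by
  have h0 : Literature.ModelTheory.ExponentialFields.IsSemialgebraic ℚ
      {z : Fin (n + 1) → ℝ | 0 < z 0} := by
    simpa using Literature.ModelTheory.ExponentialFields.isSemialgebraic_setOf_eval_pos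
      (k := ℚ) (R := ℝ) (X (0 : Fin (n + 1)))
  have h1 : Literature.ModelTheory.ExponentialFields.IsSemialgebraic ℚ
      {z : Fin (n + 1) → ℝ | z 0 < 1} := by
    simpa using Literature.ModelTheory.ExponentialFields.isSemialgebraic_setOf_eval_lt
      (k := ℚ) (R := ℝ) (X (0 : Fin (n + 1))) 1
  have h2 : Literature.ModelTheory.ExponentialFields.IsSemialgebraic ℚ
      {z : Fin (n + 1) → ℝ | (fun i : Fin n => z i.succ) ∈ r.domain} :=
    r.isSemialgebraic_domain.preimage_comp Fin.succ
  convert (h0.inter h1).inter h2 using 1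
  ext z
  simp only [cylinderDomain, mem_setOf_eq, mem_inter_iff, and_assoc]

/-- **Integrability on the cylinder**: `(s, x) ↦ f x` is absolutely integrable on `(0, 1) × σ`
(split off coordinate `0` by the volume-preserving `MeasurableEquiv.piFinSuccAbove _ 0`, whose
inverse is `vecCons`; then `Integrable.comp_snd` on `(0,1) ×ˢ σ`). [folklore] -/
lemma integrableOn_cylinderDomain :
    IntegrableOn (fun z : Fin (n + 1) → ℝ => r.integrand (fun i : Fin n => z i.succ))
      r.cylinderDomain := by
  set e : (Fin (n + 1) → ℝ) ≃ᵐ ℝ × (Fin n → ℝ) :=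
    MeasurableEquiv.piFinSuccAbove (fun _ => ℝ) 0 with he_def
  have he : MeasurePreserving e volume volume :=
    volume_preserving_piFinSuccAbove (fun _ => ℝ) 0
  have he_symm : ∀ p : ℝ × (Fin n → ℝ), e.symm p = Matrix.vecCons p.1 p.2 := fun p => by
    simp [he_def, MeasurableEquiv.piFinSuccAbove_symm_apply, Fin.insertNthEquiv,
      Fin.insertNth_zero', Matrix.vecCons]
  rw [← (he.symm e).integrableOn_comp_preimage e.symm.measurableEmbedding]
  have hpre : e.symm ⁻¹' r.cylinderDomain = Ioo (0 : ℝ) 1 ×ˢ r.domain := by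
    ext p
    rw [mem_preimage, he_symm, vecCons_mem_cylinderDomain, mem_prod, mem_Ioo]
  have hcomp : ((fun z : Fin (n + 1) → ℝ => r.integrand (fun i : Fin n => z i.succ)) ∘ e.symm) =
      fun p => r.integrand p.2 := by
    ext p
    simp [he_symm]
  rw [hpre, hcomp, IntegrableOn, Measure.volume_eq_prod, ← Measure.prod_restrict]
  exact r.integrableOn.comp_snd _

/-- **The constant family** over `r = (σ, f)`: dimension `n + 1`, domain `(0, 1) × σ` (parameter
`s = z 0`), integrand `(s, x) ↦ f x`; every slice over `0 < s < 1` is `r` itself.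
[KZ 2001, §1.2] [cite: KontsevichZagier2001, §1.2] -/
def cylinder : IntegralRep (n + 1) where
  domain := r.cylinderDomain
  integrand z := r.integrand (fun i : Fin n => z i.succ)
  isSemialgebraic_domain := r.isSemialgebraic_cylinderDomain
  isSemialgebraicFunOn_integrand :=
    r.isSemialgebraicFunOn_integrand.comp_tail.mono (fun _ hz => hz.2.2)
      r.isSemialgebraic_cylinderDomain
  integrableOn := r.integrableOn_cylinderDomain

/-- The domain of the constant family. [KZ 2001, §1.2] [cite: KontsevichZagier2001, §1.2] -/
@[simp] lemma domain_cylinder : r.cylinder.domain = r.cylinderDomain := rfl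

/-- The integrand of the constant family. [KZ 2001, §1.2] [cite: KontsevichZagier2001, §1.2] -/
@[simp] lemma integrand_cylinder :
    r.cylinder.integrand = fun z => r.integrand (fun i : Fin n => z i.succ) := rfl

/-- **The constant family is dominated**: `r.cylinder` is dominated near `s = 0⁺` by `r.abs`
(with `ε = 1`) and has the special fibre `r` (all slices over `0 < s < 1` equal `r`). In particular
`IsDominatedFamily` is inhabited non-trivially. [folklore] -/
theorem isDominatedFamily_cylinder : IsDominatedFamily r.cylinder r r.abs := by
  refine ⟨⟨1, one_pos, fun z hz _ _ => ⟨hz.2.2, ?_⟩⟩, ?_, ?_⟩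
  · simp
  · refine Eventually.of_forall fun x => ?_
    filter_upwards [Ioo_mem_nhdsGT (zero_lt_one' ℝ)] with s hs
    rw [domain_cylinder, vecCons_mem_cylinderDomain]
    exact ⟨fun h => h.2, fun h => ⟨hs, h⟩⟩
  · refine Eventually.of_forall fun x _ => ?_
    simp

end IntegralRep

end KZ

end Literature.NumberTheory.Transcendental
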